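import Literature.Barriers.FinalStateConjecture.NonSmoothNullInfinityProofs
import Mathlib.Analysis.ODE.ExistUnique
import Mathlib.MeasureTheory.Integral.IntegralEqImproper
import HarnessLib

/-!
# Barrier catalogue `FinalStateConjecture`: the Eddington–Finkelstein area radius of Schwarzschild —
# structure of `IsEFAreaRadius` (support file for the discharge of `KehrbergerLogarithmicAsymptoticsCorrected`)
(`Literature/Barriers/FinalStateConjecture/`; namespace `Literature.Barriers.FinalStateConjecture`)

`NonSmoothNullInfinity.lean` axiomatises the area radius `r(u,v)` of the Schwarzschild exterior in
Eddington–Finkelstein double null gauge by `IsEFAreaRadius M r`: `r > 2M`, `∂ᵥ r = 1 − 2M/r`,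
`∂ᵤ r = −(1 − 2M/r)` (Kehrberger, arXiv:2105.08079, §3.2 and §6.2: "`∂ᵥ r = −∂ᵤ r = 1 − 2M/r`",
with `2u = t − r*`, `2v = t + r*`, `r* = r + 2M log(r − 2M)` up to an additive constant). This file
proves the structure theorem behind the remark "any two such functions differ by translating `u`,
`v`" of that file, which every later estimate uses:

* `efTortoiseCoord M ρ = ρ + 2M log(ρ − 2M)` (the tortoise coordinate `r*` as a function of the
  area radius; the tree's `efTortoise M s` of `NonSmoothNullInfinityProofs.lean` is the same map in
  the variable `s = log(ρ − 2M)`, `efTortoiseCoord_two_mul_add_exp`) and its inverse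
  `efAreaRadius M x = 2M + exp(efTortoiseInv hM x)` (`M > 0`; the one-variable form of the tree's
  model `stdEFAreaRadius hM u v = efAreaRadius M (v − u)`, `stdEFAreaRadius_eq_efAreaRadius`), with
  `d/dx efAreaRadius = 1 − 2M/efAreaRadius`, smoothness, strict monotonicity, the elementary bounds
  `(x + 4M² + 2M)/(1 + 2M) ≤ efAreaRadius M x ≤ max x (2M + 1)` and `x − 2M log x ≤ efAreaRadius M x`
  (`x ≥ 1`), hence `efAreaRadius M x → ∞`;
* `IsEFAreaRadius.exists_eq_efAreaRadius`: for `M > 0`, every EF area radius is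
  `r(u,v) = efAreaRadius M (v − u − c)` for some constant `c` (uniqueness for the ODE
  `y' = 1 − 2M/y`, Lipschitz on `y > 2M`; equivalently `r(u,v) = stdEFAreaRadius hM (u + c) v`,
  `IsEFAreaRadius.exists_eq_stdEFAreaRadius`), and conversely `isEFAreaRadius_efAreaRadius`;
  consequently `r` is jointly smooth and invariant under `(u,v) ↦ (u + a, v + a)` (the limits
  `r → ∞` as `v → ∞` or `u → −∞` are the tree's `IsEFAreaRadius.tendsto_atTop/atBot`).

## References

* L. M. A. Kehrberger, Ann. Henri Poincaré 23 (2022) 829–921 = arXiv:2105.08079, §3.2 (the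
  Reissner–Nordström/Schwarzschild family in double null coordinates, `r*`), §6.2. Key `Kehrberger2022AHP`.
-/

noncomputable section

open Set Filter Topology MeasureTheory

namespace Literature.Barriers.FinalStateConjecture

/-! ### The tortoise coordinate and the area radius as a function of it -/

/-- The **tortoise coordinate** `r*(ρ) = ρ + 2M log(ρ − 2M)` of the Schwarzschild exterior `ρ > 2M`
(one choice of the additive constant; Kehrberger, §3.2: `r*(r) = R + ∫_R^r D⁻¹`, `D = 1 − 2M/r`).
[cite: Kehrberger2022AHP, §3.2] -/
def efTortoiseCoord (M ρ : ℝ) : ℝ := ρ + 2 * M * Real.log (ρ - 2 * M)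

/-- **The area radius as a function of the tortoise coordinate**, `efAreaRadius M : ℝ → (2M, ∞)`, the
inverse of `efTortoiseCoord M` for `M > 0`: `efAreaRadius M x = 2M + exp(efTortoiseInv hM x)` with the
tree's inverse tortoise map `efTortoiseInv` (`NonSmoothNullInfinityProofs.lean`); the junk value `0`
for `M ≤ 0` keeps `M` an explicit real argument. [cite: Kehrberger2022AHP, §3.2] -/
def efAreaRadius (M x : ℝ) : ℝ :=
  if hM : 0 < M then 2 * M + Real.exp (efTortoiseInv hM x) else 0

section Radius

variable {M : ℝ}

/-- Unfolding for `M > 0`: `efAreaRadius M x = 2M + exp(efTortoiseInv hM x)`. [folklore] -/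
lemma efAreaRadius_of_pos (hM : 0 < M) (x : ℝ) :
    efAreaRadius M x = 2 * M + Real.exp (efTortoiseInv hM x) := by
  simp [efAreaRadius, hM]

/-- **The tree's model is this function of `v − u`**: `stdEFAreaRadius hM u v = efAreaRadius M (v − u)`.
[folklore] -/
lemma stdEFAreaRadius_eq_efAreaRadius (hM : 0 < M) (u v : ℝ) :
    stdEFAreaRadius hM u v = efAreaRadius M (v - u) := by
  rw [stdEFAreaRadius, efAreaRadius_of_pos hM]

/-- The two parametrisations of the tortoise coordinate agree:
`efTortoiseCoord M (2M + eˢ) = efTortoise M s`. [folklore] -/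
lemma efTortoiseCoord_two_mul_add_exp (M s : ℝ) :
    efTortoiseCoord M (2 * M + Real.exp s) = efTortoise M s := by
  simp [efTortoiseCoord, efTortoise]

/-- `efTortoiseInv hM (efTortoise M s) = s`. [folklore] -/
lemma efTortoiseInv_efTortoise (hM : 0 < M) (s : ℝ) : efTortoiseInv hM (efTortoise M s) = s :=
  (strictMono_efTortoise hM).injective (efTortoise_efTortoiseInv hM _)

/-- `efAreaRadius M x > 2M` (`M > 0`). [folklore] -/
lemma two_mul_lt_efAreaRadius (hM : 0 < M) (x : ℝ) : 2 * M < efAreaRadius M x := by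
  rw [efAreaRadius_of_pos hM]
  linarith [Real.exp_pos (efTortoiseInv hM x)]

/-- `efAreaRadius M x > 0` (`M > 0`). [folklore] -/
lemma efAreaRadius_pos (hM : 0 < M) (x : ℝ) : 0 < efAreaRadius M x :=
  lt_trans (by positivity) (two_mul_lt_efAreaRadius hM x)

/-- `r*(r(x)) = x`: `efTortoiseCoord M (efAreaRadius M x) = x` (`M > 0`). [folklore] -/
lemma efTortoiseCoord_efAreaRadius (hM : 0 < M) (x : ℝ) : efTortoiseCoord M (efAreaRadius M x) = x := by
  rw [efAreaRadius_of_pos hM, efTortoiseCoord_two_mul_add_exp, efTortoise_efTortoiseInv]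

/-- `r(r*(ρ)) = ρ` for `ρ > 2M`: `efAreaRadius M (efTortoiseCoord M ρ) = ρ` (`M > 0`). [folklore] -/
lemma efAreaRadius_efTortoiseCoord (hM : 0 < M) {ρ : ℝ} (hρ : 2 * M < ρ) :
    efAreaRadius M (efTortoiseCoord M ρ) = ρ := by
  have hρ' : 0 < ρ - 2 * M := by linarith
  have h1 : efTortoiseCoord M ρ = efTortoise M (Real.log (ρ - 2 * M)) := by
    rw [← efTortoiseCoord_two_mul_add_exp, Real.exp_log hρ']
    ring_nf
  rw [efAreaRadius_of_pos hM, h1, efTortoiseInv_efTortoise hM, Real.exp_log hρ']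
  ring

/-- `efAreaRadius M` is injective... indeed strictly increasing (below); here: `efTortoiseCoord` is a left
inverse on `(2M, ∞)`, so `efAreaRadius M` is a bijection `ℝ → (2M, ∞)`. [folklore] -/
lemma efAreaRadius_injective (hM : 0 < M) : Function.Injective (efAreaRadius M) := fun x y h ↦ by
  rw [← efTortoiseCoord_efAreaRadius hM x, ← efTortoiseCoord_efAreaRadius hM y, h]

/-- **`dr/dr* = 1 − 2M/r`**: `efAreaRadius M` has derivative `1 − 2M/efAreaRadius M x` at every `x`
(inverse function rule; Kehrberger §3.2: `∂ᵥ r = 1 − 2M/r` along `u = const`, where `v = r* + const`).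
[cite: Kehrberger2022AHP, §3.2] -/
theorem hasDerivAt_efAreaRadius (hM : 0 < M) (x : ℝ) :
    HasDerivAt (efAreaRadius M) (1 - 2 * M / efAreaRadius M x) x := by
  have heq : efAreaRadius M = fun x ↦ 2 * M + Real.exp (efTortoiseInv hM x) :=
    funext (efAreaRadius_of_pos hM)
  rw [heq]
  exact hasDerivAt_stdEFAreaRadius_aux hM x

/-- `deriv (efAreaRadius M) x = 1 − 2M/efAreaRadius M x`. [folklore] -/
lemma deriv_efAreaRadius (hM : 0 < M) (x : ℝ) :
    deriv (efAreaRadius M) x = 1 - 2 * M / efAreaRadius M x :=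
  (hasDerivAt_efAreaRadius hM x).deriv

/-- `efAreaRadius M` is differentiable. [folklore] -/
lemma differentiable_efAreaRadius (hM : 0 < M) : Differentiable ℝ (efAreaRadius M) :=
  fun x ↦ (hasDerivAt_efAreaRadius hM x).differentiableAt

/-- `efAreaRadius M` is continuous. [folklore] -/
lemma continuous_efAreaRadius (hM : 0 < M) : Continuous (efAreaRadius M) :=
  (differentiable_efAreaRadius hM).continuous

/-- The derivative `1 − 2M/r` is positive. [folklore] -/
lemma deriv_efAreaRadius_pos (hM : 0 < M) (x : ℝ) : 0 < 1 - 2 * M / efAreaRadius M x := by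
  rw [sub_pos, div_lt_one (efAreaRadius_pos hM x)]
  exact two_mul_lt_efAreaRadius hM x

/-- The derivative `1 − 2M/r` is at most `1`. [folklore] -/
lemma deriv_efAreaRadius_le_one (hM : 0 < M) (x : ℝ) : 1 - 2 * M / efAreaRadius M x ≤ 1 := by
  have := div_nonneg (by positivity : (0 : ℝ) ≤ 2 * M) (efAreaRadius_pos hM x).le
  linarith

/-- `efAreaRadius M` is of class `C^n` for every finite `n` (bootstrap: its derivative is a smooth
function of itself). [folklore] -/
lemma contDiff_efAreaRadius_nat (hM : 0 < M) : ∀ n : ℕ, ContDiff ℝ n (efAreaRadius M) := by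
  intro n
  induction n with
  | zero => exact contDiff_zero.2 (continuous_efAreaRadius hM)
  | succ n ih =>
    rw [show ((n + 1 : ℕ) : WithTop ℕ∞) = (n : WithTop ℕ∞) + 1 by push_cast; rfl,
      contDiff_succ_iff_deriv]
    refine ⟨differentiable_efAreaRadius hM, fun h ↦ absurd h (by simp), ?_⟩
    have hd : deriv (efAreaRadius M) = fun x ↦ 1 - 2 * M / efAreaRadius M x :=
      funext (deriv_efAreaRadius hM)
    rw [hd]
    exact contDiff_const.sub (contDiff_const.div ih fun x ↦ (efAreaRadius_pos hM x).ne')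

/-- **`efAreaRadius M` is smooth.** [folklore] -/
theorem contDiff_efAreaRadius (hM : 0 < M) :
    ContDiff ℝ ((⊤ : ℕ∞) : WithTop ℕ∞) (efAreaRadius M) :=
  contDiff_infty.2 (contDiff_efAreaRadius_nat hM)

/-- `efAreaRadius M` is strictly increasing. [folklore] -/
theorem strictMono_efAreaRadius (hM : 0 < M) : StrictMono (efAreaRadius M) :=
  strictMono_of_deriv_pos fun x ↦ by rw [deriv_efAreaRadius hM x]; exact deriv_efAreaRadius_pos hM x

/-- **Linear lower bound**: `(x + 4M² + 2M)/(1 + 2M) ≤ efAreaRadius M x` (from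
`x = r + 2M log(r − 2M) ≤ r + 2M(r − 2M − 1)`, `log y ≤ y − 1`). [folklore] -/
theorem efAreaRadius_ge_linear (hM : 0 < M) (x : ℝ) :
    (x + 4 * M ^ 2 + 2 * M) / (1 + 2 * M) ≤ efAreaRadius M x := by
  set ρ := efAreaRadius M x with hρ
  have h2 : 2 * M < ρ := two_mul_lt_efAreaRadius hM x
  have hlog : Real.log (ρ - 2 * M) ≤ ρ - 2 * M - 1 := Real.log_le_sub_one_of_pos (by linarith)
  have hx : x = ρ + 2 * M * Real.log (ρ - 2 * M) := by
    rw [hρ, ← efTortoiseCoord, efTortoiseCoord_efAreaRadius hM x]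
  rw [div_le_iff₀ (by positivity)]
  nlinarith [mul_le_mul_of_nonneg_left hlog (by positivity : (0 : ℝ) ≤ 2 * M)]

/-- **Upper bound**: `efAreaRadius M x ≤ max x (2M + 1)` (if `r − 2M ≥ 1` then `log(r − 2M) ≥ 0`, so
`r ≤ r* = x`). [folklore] -/
theorem efAreaRadius_le_max (hM : 0 < M) (x : ℝ) : efAreaRadius M x ≤ max x (2 * M + 1) := by
  set ρ := efAreaRadius M x with hρ
  have hx : x = ρ + 2 * M * Real.log (ρ - 2 * M) := by
    rw [hρ, ← efTortoiseCoord, efTortoiseCoord_efAreaRadius hM x]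
  rcases le_or_gt 1 (ρ - 2 * M) with h1 | h1
  · have hlog : 0 ≤ Real.log (ρ - 2 * M) := Real.log_nonneg h1
    exact le_trans (by nlinarith [mul_nonneg (by positivity : (0:ℝ) ≤ 2 * M) hlog]) (le_max_left _ _)
  · exact le_trans (by linarith) (le_max_right _ _)

/-- **Logarithmic lower bound**: `x − 2M log x ≤ efAreaRadius M x` for `x ≥ 1` (so
`|r − r*| = O(log r*)`, cf. Kehrberger, Lemma 4.1: `|r(u,v) − (v − u)| = O(log r)`). [folklore] -/
theorem sub_log_le_efAreaRadius (hM : 0 < M) {x : ℝ} (hx1 : 1 ≤ x) :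
    x - 2 * M * Real.log x ≤ efAreaRadius M x := by
  set ρ := efAreaRadius M x with hρ
  have h2 : 2 * M < ρ := two_mul_lt_efAreaRadius hM x
  have hx : x = ρ + 2 * M * Real.log (ρ - 2 * M) := by
    rw [hρ, ← efTortoiseCoord, efTortoiseCoord_efAreaRadius hM x]
  have hM2 : (0 : ℝ) ≤ 2 * M := by positivity
  rcases le_or_gt 1 (ρ - 2 * M) with h1 | h1
  · -- `ρ ≤ x` and `log (ρ - 2M) ≤ log x`
    have hlog0 : 0 ≤ Real.log (ρ - 2 * M) := Real.log_nonneg h1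
    have hρx : ρ ≤ x := by nlinarith [mul_nonneg hM2 hlog0]
    have hlog : Real.log (ρ - 2 * M) ≤ Real.log x :=
      Real.log_le_log (by linarith) (by linarith)
    nlinarith [mul_le_mul_of_nonneg_left hlog hM2]
  · -- `log (ρ - 2M) < 0`, so `ρ > x ≥ x - 2M log x`
    have hlog0 : Real.log (ρ - 2 * M) < 0 := Real.log_neg (by linarith) h1
    have hlogx : 0 ≤ Real.log x := Real.log_nonneg hx1
    nlinarith [mul_nonneg hM2 hlogx, mul_le_mul_of_nonneg_left hlog0.le hM2]

/-- `efAreaRadius M x → ∞` as `x → ∞`. [folklore] -/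
theorem tendsto_efAreaRadius_atTop (hM : 0 < M) : Tendsto (efAreaRadius M) atTop atTop := by
  have h : Tendsto (fun x : ℝ ↦ (x + 4 * M ^ 2 + 2 * M) / (1 + 2 * M)) atTop atTop :=
    Tendsto.atTop_div_const (by positivity)
      (tendsto_atTop_add_const_right _ _ (tendsto_atTop_add_const_right _ _ tendsto_id))
  exact tendsto_atTop_mono (efAreaRadius_ge_linear hM) h

/-! ### The vector field `y ↦ 1 − 2M/y` is Lipschitz on `y > 2M` -/

/-- `y ↦ 1 − 2M/y` is `(2M)⁻¹`-Lipschitz on `(2M, ∞)` (`M > 0`). [folklore] -/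
lemma lipschitzOnWith_efField (hM : 0 < M) :
    LipschitzOnWith (Real.toNNReal (2 * M)⁻¹) (fun y : ℝ ↦ 1 - 2 * M / y) (Ioi (2 * M)) := by
  refine LipschitzOnWith.of_dist_le_mul fun y₁ h₁ y₂ h₂ ↦ ?_
  have h2M : (0 : ℝ) < 2 * M := by positivity
  rw [Real.coe_toNNReal _ (inv_nonneg.2 h2M.le), Real.dist_eq, Real.dist_eq]
  have hy₁ : (0 : ℝ) < y₁ := lt_trans h2M h₁
  have hy₂ : (0 : ℝ) < y₂ := lt_trans h2M h₂
  have heq : (1 - 2 * M / y₁) - (1 - 2 * M / y₂) = 2 * M * (y₁ - y₂) / (y₁ * y₂) := by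
    field_simp; ring
  rw [heq, abs_div, abs_mul, abs_of_pos h2M, abs_of_pos (mul_pos hy₁ hy₂)]
  rw [div_le_iff₀ (mul_pos hy₁ hy₂)]
  have hprod : (2 * M) * (2 * M) ≤ y₁ * y₂ :=
    mul_le_mul (le_of_lt (mem_Ioi.1 h₁)) (le_of_lt (mem_Ioi.1 h₂)) h2M.le hy₁.le
  have habs : 0 ≤ |y₁ - y₂| := abs_nonneg _
  calc 2 * M * |y₁ - y₂| = (2 * M)⁻¹ * |y₁ - y₂| * ((2 * M) * (2 * M)) := by field_simp
    _ ≤ (2 * M)⁻¹ * |y₁ - y₂| * (y₁ * y₂) :=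
        mul_le_mul_of_nonneg_left hprod (mul_nonneg (inv_nonneg.2 h2M.le) habs)

/-- `y ↦ −(1 − 2M/y)` is `(2M)⁻¹`-Lipschitz on `(2M, ∞)` (`M > 0`). [folklore] -/
lemma lipschitzOnWith_neg_efField (hM : 0 < M) :
    LipschitzOnWith (Real.toNNReal (2 * M)⁻¹) (fun y : ℝ ↦ -(1 - 2 * M / y)) (Ioi (2 * M)) := by
  refine LipschitzOnWith.of_dist_le_mul fun y₁ h₁ y₂ h₂ ↦ ?_
  rw [dist_neg_neg]
  exact (lipschitzOnWith_efField hM).dist_le_mul y₁ h₁ y₂ h₂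

/-! ### The structure theorem for `IsEFAreaRadius` -/

/-- **Model**: for every constant `c`, `(u, v) ↦ efAreaRadius M (v − u − c)` is an EF area radius of
mass `M > 0` (in particular `IsEFAreaRadius M` is inhabited). [cite: Kehrberger2022AHP, §3.2] -/
theorem isEFAreaRadius_efAreaRadius (hM : 0 < M) (c : ℝ) :
    IsEFAreaRadius M (fun u v ↦ efAreaRadius M (v - u - c)) := by
  refine ⟨fun u v ↦ two_mul_lt_efAreaRadius hM _, fun u v ↦ ?_, fun u v ↦ ?_⟩
  · have hlin : HasDerivAt (fun v' : ℝ ↦ v' - u - c) 1 v := by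
      simpa using ((hasDerivAt_id v).sub_const u).sub_const c
    refine ((hasDerivAt_efAreaRadius hM (v - u - c)).comp v hlin).congr_deriv ?_
    ring
  · have hlin : HasDerivAt (fun u' : ℝ ↦ v - u' - c) (-1) u := by
      simpa using ((hasDerivAt_const u v).sub (hasDerivAt_id u)).sub_const c
    refine ((hasDerivAt_efAreaRadius hM (v - u - c)).comp u hlin).congr_deriv ?_
    ring

/-- **Structure theorem**: for `M > 0`, every EF area radius is `r(u, v) = efAreaRadius M (v − u − c)`
for some constant `c` (indeed a unique one, by injectivity of `efAreaRadius M`, not recorded here) — uniqueness of solutions of `y' = ±(1 − 2M/y)` on `y > 2M`, first along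
`u = 0`, then along each `v = const` ("any two such functions differ by `(u,v) ↦ (u + c, v + c')`",
`NonSmoothNullInfinity.lean`; Kehrberger §3.2: `2u = t − r*`, `2v = t + r*`).
[cite: Kehrberger2022AHP, §3.2] -/
theorem IsEFAreaRadius.exists_eq_efAreaRadius {r : ℝ → ℝ → ℝ} (hr : IsEFAreaRadius M r)
    (hM : 0 < M) : ∃ c : ℝ, ∀ u v, r u v = efAreaRadius M (v - u - c) := by
  obtain ⟨hgt, hdv, hdu⟩ := hr
  set c : ℝ := -efTortoiseCoord M (r 0 0) with hc
  have hmodel := isEFAreaRadius_efAreaRadius hM c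
  obtain ⟨-, hmdv, hmdu⟩ := hmodel
  refine ⟨c, ?_⟩
  -- along `u = 0`
  have h0 : (fun v ↦ r 0 v) = fun v ↦ efAreaRadius M (v - 0 - c) := by
    refine ODE_solution_unique_univ (v := fun _ y ↦ 1 - 2 * M / y) (s := fun _ ↦ Ioi (2 * M))
      (t₀ := 0) (fun _ ↦ lipschitzOnWith_efField hM) (fun v ↦ ⟨hdv 0 v, hgt 0 v⟩)
      (fun v ↦ ⟨hmdv 0 v, two_mul_lt_efAreaRadius hM _⟩) ?_
    simp [hc, efAreaRadius_efTortoiseCoord hM (hgt 0 0)]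
  intro u v
  -- along `v = const`
  have h1 : (fun u' ↦ r u' v) = fun u' ↦ efAreaRadius M (v - u' - c) := by
    refine ODE_solution_unique_univ (v := fun _ y ↦ -(1 - 2 * M / y)) (s := fun _ ↦ Ioi (2 * M))
      (t₀ := 0) (fun _ ↦ lipschitzOnWith_neg_efField hM) (fun u' ↦ ⟨hdu u' v, hgt u' v⟩)
      (fun u' ↦ ⟨hmdu u' v, two_mul_lt_efAreaRadius hM _⟩) ?_
    exact congrFun h0 v
  exact congrFun h1 u

/-- **Structure theorem, tree-model form**: every EF area radius (`M > 0`) is a `u`-translate of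
the standard one, `r(u, v) = stdEFAreaRadius hM (u + c) v`. [cite: Kehrberger2022AHP, §3.2] -/
theorem IsEFAreaRadius.exists_eq_stdEFAreaRadius {r : ℝ → ℝ → ℝ} (hr : IsEFAreaRadius M r)
    (hM : 0 < M) : ∃ c : ℝ, ∀ u v, r u v = stdEFAreaRadius hM (u + c) v := by
  obtain ⟨c, hc⟩ := hr.exists_eq_efAreaRadius hM
  refine ⟨c, fun u v ↦ ?_⟩
  rw [hc, stdEFAreaRadius_eq_efAreaRadius]
  ring_nf

/-- An EF area radius (`M > 0`) is invariant under the simultaneous translation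
`(u, v) ↦ (u + a, v + a)` (it is a function of `v − u`). [folklore] -/
theorem IsEFAreaRadius.radius_add_add {r : ℝ → ℝ → ℝ} (hr : IsEFAreaRadius M r) (hM : 0 < M)
    (u v a : ℝ) : r (u + a) (v + a) = r u v := by
  obtain ⟨c, hc⟩ := hr.exists_eq_efAreaRadius hM
  rw [hc, hc]
  ring_nf

/-- An EF area radius (`M > 0`) is jointly smooth. [folklore] -/
theorem IsEFAreaRadius.contDiff_uncurry {r : ℝ → ℝ → ℝ} (hr : IsEFAreaRadius M r) (hM : 0 < M) :
    ContDiff ℝ ((⊤ : ℕ∞) : WithTop ℕ∞) (Function.uncurry r) := by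
  obtain ⟨c, hc⟩ := hr.exists_eq_efAreaRadius hM
  have heq : Function.uncurry r = (efAreaRadius M) ∘ fun p : ℝ × ℝ ↦ p.2 - p.1 - c := by
    funext p; simp [Function.uncurry, hc]
  rw [heq]
  exact (contDiff_efAreaRadius hM).comp ((contDiff_snd.sub contDiff_fst).sub contDiff_const)

/-- The area radius is strictly increasing in `v` (`M > 0`). [folklore] -/
theorem IsEFAreaRadius.strictMono_right {r : ℝ → ℝ → ℝ} (hr : IsEFAreaRadius M r) (hM : 0 < M)
    (u : ℝ) : StrictMono (fun v ↦ r u v) := by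
  obtain ⟨c, hc⟩ := hr.exists_eq_efAreaRadius hM
  intro v₁ v₂ h
  simp only [hc]
  exact strictMono_efAreaRadius hM (by linarith)

/-- The area radius is strictly decreasing in `u` (`M > 0`). [folklore] -/
theorem IsEFAreaRadius.strictAnti_left {r : ℝ → ℝ → ℝ} (hr : IsEFAreaRadius M r) (hM : 0 < M)
    (v : ℝ) : StrictAnti (fun u ↦ r u v) := by
  obtain ⟨c, hc⟩ := hr.exists_eq_efAreaRadius hM
  intro u₁ u₂ h
  simp only [hc]
  exact strictMono_efAreaRadius hM (by linarith)

end Radius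

/-! ### The potential of the spherically symmetric wave equation and its exact null-line integrals -/

section Potential

variable {M : ℝ}

/-- The **potential** `V(ρ) = 2M (1 − 2M/ρ)/ρ³` of the spherically symmetric linear wave equation on
Schwarzschild written for the radiation field, `∂ᵤ∂ᵥ(rφ) = −V(r) · rφ` (Kehrberger, §6.2,
eq. (6.14): "`∂ᵤ∂ᵥ(rφ) = −2M(1 − 2M/r) rφ/r³`"). [cite: Kehrberger2022AHP, §6.2 eq. (6.14)] -/
def radialPotential (M ρ : ℝ) : ℝ := 2 * M * (1 - 2 * M / ρ) / ρ ^ 3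

/-- The right-hand side of `IsRadiationFieldOnSchwarzschild` is `−V(r) ψ`. [folklore] -/
lemma neg_radialPotential_mul (M ρ x : ℝ) :
    -2 * M * (1 - 2 * M / ρ) * x / ρ ^ 3 = -radialPotential M ρ * x := by
  simp only [radialPotential]
  ring

/-- The (signed) potential `efPotential M r u v = −2M(1 − 2M/r)/r³` of
`NonSmoothNullInfinityProofs.lean` is `−radialPotential M (r u v)`. [folklore] -/
lemma efPotential_eq_neg_radialPotential (M : ℝ) (r : ℝ → ℝ → ℝ) (u v : ℝ) :
    efPotential M r u v = -radialPotential M (r u v) := by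
  simp only [efPotential, radialPotential]
  ring

/-- `V(ρ) = 2M/ρ³ − 4M²/ρ⁴` for `ρ ≠ 0`. [folklore] -/
lemma radialPotential_eq (M : ℝ) {ρ : ℝ} (hρ : ρ ≠ 0) :
    radialPotential M ρ = 2 * M / ρ ^ 3 - 4 * M ^ 2 / ρ ^ 4 := by
  simp only [radialPotential]
  field_simp
  ring

/-- `V > 0` on the exterior `ρ > 2M` (`M > 0`). [folklore] -/
lemma radialPotential_pos (hM : 0 < M) {ρ : ℝ} (hρ : 2 * M < ρ) : 0 < radialPotential M ρ := by
  have hρ0 : 0 < ρ := lt_trans (by positivity) hρ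
  have hD : 0 < 1 - 2 * M / ρ := by rw [sub_pos, div_lt_one hρ0]; exact hρ
  simp only [radialPotential]
  positivity

/-- `V ≤ 2M/ρ³` for `ρ > 0`, `M ≥ 0`. [folklore] -/
lemma radialPotential_le (hM : 0 ≤ M) {ρ : ℝ} (hρ : 0 < ρ) : radialPotential M ρ ≤ 2 * M / ρ ^ 3 := by
  simp only [radialPotential]
  have h1 : 1 - 2 * M / ρ ≤ 1 := by
    have := div_nonneg (by positivity : (0 : ℝ) ≤ 2 * M) hρ.le
    linarith
  calc 2 * M * (1 - 2 * M / ρ) / ρ ^ 3 ≤ 2 * M * 1 / ρ ^ 3 := by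
        gcongr
    _ = 2 * M / ρ ^ 3 := by ring

/-- `V` is smooth away from `ρ = 0`, in particular on the exterior. [folklore] -/
lemma contDiffOn_radialPotential (M : ℝ) :
    ContDiffOn ℝ ((⊤ : ℕ∞) : WithTop ℕ∞) (radialPotential M) {ρ | ρ ≠ 0} := by
  have h : ∀ ρ ∈ {ρ : ℝ | ρ ≠ 0}, radialPotential M ρ = 2 * M / ρ ^ 3 - 4 * M ^ 2 / ρ ^ 4 :=
    fun ρ hρ ↦ radialPotential_eq M hρ
  refine ContDiffOn.congr ?_ h
  refine ContDiffOn.sub ?_ ?_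
  · exact contDiffOn_const.div (contDiffOn_id.pow 3) fun ρ hρ ↦ pow_ne_zero 3 hρ
  · exact contDiffOn_const.div (contDiffOn_id.pow 4) fun ρ hρ ↦ pow_ne_zero 4 hρ

/-- **Integrability of a nonnegative derivative on `(−∞, a]`**: if `g' ≥ 0` is the derivative of `g` on
`(−∞, a]` and `g` has a limit at `−∞`, then `g'` is integrable on `Iic a` (the mirror image of
Mathlib's `integrableOn_Ioi_deriv_of_nonneg'`; a general lemma — TODO upstream / move to
`Literature/Analysis`). [folklore] -/
theorem integrableOn_Iic_deriv_of_nonneg' {g g' : ℝ → ℝ} {a l : ℝ}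
    (hderiv : ∀ x ∈ Iic a, HasDerivAt g (g' x) x) (g'pos : ∀ x ∈ Iic a, 0 ≤ g' x)
    (hg : Tendsto g atBot (𝓝 l)) : IntegrableOn g' (Iic a) := by
  have hcont : ContinuousOn g (Iic a) := fun x hx ↦ (hderiv x hx).continuousAt.continuousWithinAt
  have hint : ∀ y : ℝ, IntegrableOn g' (Ioc y a) := fun y ↦ by
    rcases le_or_gt y a with hya | hya
    · exact intervalIntegral.integrableOn_deriv_of_nonneg (hcont.mono Icc_subset_Iic_self)
        (fun x hx ↦ hderiv x hx.2.le) fun x hx ↦ g'pos x hx.2.le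
    · rw [Ioc_eq_empty (not_lt.2 hya.le)]
      exact integrableOn_empty
  refine integrableOn_Iic_of_intervalIntegral_norm_tendsto (g a - l) a hint tendsto_id ?_
  apply Tendsto.congr' _ ((tendsto_const_nhds (x := g a)).sub hg)
  filter_upwards [Iic_mem_atBot a] with y hy
  have hy' : id y ≤ a := hy
  calc g a - g y = ∫ x in id y..a, g' x := by
        symm
        apply intervalIntegral.integral_eq_sub_of_hasDerivAt_of_le hy'
          (hcont.mono Icc_subset_Iic_self) fun x hx ↦ hderiv x hx.2.le
        rw [intervalIntegrable_iff_integrableOn_Ioc_of_le hy']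
        exact hint y
    _ = ∫ x in id y..a, ‖g' x‖ := by
        simp_rw [intervalIntegral.integral_of_le hy']
        refine setIntegral_congr_fun measurableSet_Ioc fun x hx ↦ ?_
        rw [Real.norm_eq_abs, abs_of_nonneg (g'pos x hx.2)]

variable {r : ℝ → ℝ → ℝ}

/-- Along an ingoing null line `v = const`, `u ↦ M/r(u,v)²` is an antiderivative of the potential:
`∂ᵤ(M/r²) = −2M ∂ᵤr/r³ = 2M(1 − 2M/r)/r³ = V(r)`. [folklore] -/
theorem IsEFAreaRadius.hasDerivAt_div_sq (hr : IsEFAreaRadius M r) (hM : 0 < M) (u v : ℝ) :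
    HasDerivAt (fun u' ↦ M / r u' v ^ 2) (radialPotential M (r u v)) u := by
  have hr0 : r u v ≠ 0 := (hr.pos hM.le u v).ne'
  have h : HasDerivAt (fun u' ↦ M / r u' v ^ 2)
      ((0 * r u v ^ 2 - M * ((2 : ℕ) * r u v ^ (2 - 1) * -(1 - 2 * M / r u v))) /
        (r u v ^ 2) ^ 2) u :=
    (hasDerivAt_const u M).div ((hr.2.2 u v).pow 2) (pow_ne_zero 2 hr0)
  refine h.congr_deriv ?_
  norm_num [radialPotential]
  field_simp
  ring

/-- `M/r(u,v)² → 0` as `u → −∞` (`M > 0`). [folklore] -/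
lemma IsEFAreaRadius.tendsto_div_sq_atBot (hr : IsEFAreaRadius M r) (hM : 0 < M) (v : ℝ) :
    Tendsto (fun u ↦ M / r u v ^ 2) atBot (𝓝 0) := by
  have h := ((tendsto_pow_atTop (n := 2) (by norm_num)).comp (hr.tendsto_atBot hM.le v)).inv_tendsto_atTop
  simpa [div_eq_mul_inv] using h.const_mul M

/-- The potential is integrable along every ingoing null line towards `𝓘⁻`. [folklore] -/
theorem IsEFAreaRadius.integrableOn_potential_Iic (hr : IsEFAreaRadius M r) (hM : 0 < M)
    (u v : ℝ) : IntegrableOn (fun u' ↦ radialPotential M (r u' v)) (Iic u) :=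
  integrableOn_Iic_deriv_of_nonneg' (fun u' _ ↦ hr.hasDerivAt_div_sq hM u' v)
    (fun u' _ ↦ (radialPotential_pos hM (hr.1 u' v)).le) (hr.tendsto_div_sq_atBot hM v)

/-- **The exact ingoing null-line integral of the potential**:
`∫_{−∞}^{u} V(r(u',v)) du' = M/r(u,v)²` (substitute `dr = −(1 − 2M/r) du`:
`∫_{r(u,v)}^{∞} 2M/ρ³ dρ`). This is the first-order (Born) response of the scattering problem and the
source of every `M/r²`, `1/|u|²` in Kehrberger's §6. [folklore] -/
theorem IsEFAreaRadius.integral_potential_Iic (hr : IsEFAreaRadius M r) (hM : 0 < M) (u v : ℝ) :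
    ∫ u' in Iic u, radialPotential M (r u' v) = M / r u v ^ 2 := by
  have h := integral_Iic_of_hasDerivAt_of_tendsto' (fun u' _ ↦ hr.hasDerivAt_div_sq hM u' v)
    (hr.integrableOn_potential_Iic hM u v) (hr.tendsto_div_sq_atBot hM v)
  simpa using h

/-- `u ↦ M/r(u,v)²` is non-decreasing (`r` decreases in `u`); with `integral_potential_Iic` this
says that the ingoing null-line integrals `∫_{−∞}^{u} V = M/r(u,v)²` increase towards the future.
[folklore] -/
lemma IsEFAreaRadius.div_sq_le_div_sq (hr : IsEFAreaRadius M r) (hM : 0 < M) {u₁ u₂ : ℝ}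
    (h : u₁ ≤ u₂) (v : ℝ) : M / r u₁ v ^ 2 ≤ M / r u₂ v ^ 2 := by
  have h12 : r u₂ v ≤ r u₁ v := (hr.strictAnti_left hM v).antitone h
  have h2 : 0 < r u₂ v := hr.pos hM.le u₂ v
  gcongr

end Potential

end Literature.Barriers.FinalStateConjecture

end
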